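import Summits.NavierStokesRegularity.NavierStokesRegularity.Theorems.SymmetricScarExists.Negative.SpiralWorld
import Summits.NavierStokesRegularity.NavierStokesRegularity.Theorems.SymmetricScarExists.Negative.LocalTypeIBarrier
import Literature.Analysis.FluidPDE.LocalLeraySolutions

/-!
# `SymmetricScarExists` (crux stmt-NavierStokesRegularity-11718, route RellichScar): the
# singularity of the ANTECEDENT profile is load-bearing — negative-side support, part 4 (cdisprove seat)

Dropping `IsBackwardSingularPoint u 0` from the antecedent only (keeping it in the conclusion) turns
the crux into the bare existence statement "a singular apex profile with a homogeneous or
axisymmetric scar exists" — the zero flow inhabits the weakened antecedent at `C = 0`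
(tree `isSuitableWeakSolutionOn_zero`, `hasWeakSpatialGradientOn_zero`, `typeIBound_zero`) —, which
implies the registered OPEN statement `LocalTypeISingularityExists` (Albritton–Barker 2019 Thm 1.1,
first bullet) by the packaging theorem `localTypeISingularityExists_of_slabProfile`.  Hence under
`¬ LocalTypeISingularityExists` (e.g. in the KNSS (L)-world) the crux is TRUE
(`symmetricScarExists_of_not_localTypeISingularityExists`, part `LocalTypeIBarrier`) while the
weakening is FALSE (`symmetricScarExists_false_without_singularAntecedent`): any proof of the crux
must use the antecedent's singularity; the crux is a selection statement, not a construction.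

## References

* D. Albritton, T. Barker, J. Math. Fluid Mech. 21 (2019) = arXiv:1811.00502, Thm 1.1. [AlbrittonBarker2019]
-/

noncomputable section

open MeasureTheory Set Function Filter Topology TopologicalSpace Metric
open scoped NNReal ENNReal

namespace Summit.NavierStokesRegularity.NavierStokesRegularity.Theorems.SymmetricScarExists.Negative

open Literature.Analysis.FluidPDE
open Summit.NavierStokesRegularity.NavierStokesRegularity.Theses.RellichScar

section LoadBearing

/-- The crux with the singularity hypothesis dropped from the ANTECEDENT only. -/
def SymmetricScarExistsWithoutSingularAntecedent : Prop :=
  ∀ C : ℝ, (∃ (u : ℝ → (EuclideanSpace ℝ (Fin 3)) → (EuclideanSpace ℝ (Fin 3))) (p : ℝ → (EuclideanSpace ℝ (Fin 3)) → ℝ) (G : ℝ → (EuclideanSpace ℝ (Fin 3)) → (EuclideanSpace ℝ (Fin 3)) →L[ℝ] (EuclideanSpace ℝ (Fin 3))),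
      IsSuitableWeakSolutionOn (slab (EuclideanSpace ℝ (Fin 3)) (Iio (0 : ℝ)) isOpen_Iio) 1 0 u p ∧ HasWeakSpatialGradientOn (slab (EuclideanSpace ℝ (Fin 3)) (Iio (0 : ℝ)) isOpen_Iio) u G ∧
      typeIBound (Iio (0 : ℝ) ×ˢ univ) u p G < ⊤ ∧ HasTypeIDecay C u) →
    ∃ (C' : ℝ) (u : ℝ → (EuclideanSpace ℝ (Fin 3)) → (EuclideanSpace ℝ (Fin 3))) (p : ℝ → (EuclideanSpace ℝ (Fin 3)) → ℝ) (G : ℝ → (EuclideanSpace ℝ (Fin 3)) → (EuclideanSpace ℝ (Fin 3)) →L[ℝ] (EuclideanSpace ℝ (Fin 3))),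
      IsSuitableWeakSolutionOn (slab (EuclideanSpace ℝ (Fin 3)) (Iio (0 : ℝ)) isOpen_Iio) 1 0 u p ∧ HasWeakSpatialGradientOn (slab (EuclideanSpace ℝ (Fin 3)) (Iio (0 : ℝ)) isOpen_Iio) u G ∧
      typeIBound (Iio (0 : ℝ) ×ˢ univ) u p G < ⊤ ∧ HasTypeIDecay C' u ∧
      IsBackwardSingularPoint u 0 ∧ (HomScar u ∨ AxiScar u)

/-- The zero flow inhabits the weakened antecedent at `C = 0` (tree `isSuitableWeakSolutionOn_zero`,
`hasWeakSpatialGradientOn_zero`, `typeIBound_zero`). [folklore] -/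
theorem zero_mem_apexClass :
    IsSuitableWeakSolutionOn (slab (EuclideanSpace ℝ (Fin 3)) (Iio (0 : ℝ)) isOpen_Iio) 1 0 (0 : ℝ → (EuclideanSpace ℝ (Fin 3)) → (EuclideanSpace ℝ (Fin 3))) (0 : ℝ → (EuclideanSpace ℝ (Fin 3)) → ℝ) ∧
      HasWeakSpatialGradientOn (slab (EuclideanSpace ℝ (Fin 3)) (Iio (0 : ℝ)) isOpen_Iio) (0 : ℝ → (EuclideanSpace ℝ (Fin 3)) → (EuclideanSpace ℝ (Fin 3))) (0 : ℝ → (EuclideanSpace ℝ (Fin 3)) → (EuclideanSpace ℝ (Fin 3)) →L[ℝ] (EuclideanSpace ℝ (Fin 3))) ∧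
      typeIBound (Iio (0 : ℝ) ×ˢ univ) (0 : ℝ → (EuclideanSpace ℝ (Fin 3)) → (EuclideanSpace ℝ (Fin 3))) 0 0 < ⊤ ∧
      HasTypeIDecay 0 (0 : ℝ → (EuclideanSpace ℝ (Fin 3)) → (EuclideanSpace ℝ (Fin 3))) := by
  refine ⟨isSuitableWeakSolutionOn_zero _ 1, hasWeakSpatialGradientOn_zero _, ?_, fun t _ x => ?_⟩
  · rw [typeIBound_zero]
    exact ENNReal.zero_lt_top
  · simp

/-- **Without the antecedent's singularity the crux asserts a Type-I singularity**: the weakened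
crux implies `LocalTypeISingularityExists` (its consequent, fed by the zero flow, is a singular
apex profile, packaged by `localTypeISingularityExists_of_slabProfile`). [cite: AlbrittonBarker2019, Thm 1.1] -/
theorem localTypeISingularityExists_of_withoutSingularAntecedent
    (h : SymmetricScarExistsWithoutSingularAntecedent) : LocalTypeISingularityExists := by
  obtain ⟨hsw, hwg, hI, hdec⟩ := zero_mem_apexClass
  obtain ⟨-, u, p, G, hsw', hwg', hI', -, hsing', -⟩ := h 0 ⟨0, 0, 0, hsw, hwg, hI, hdec⟩
  exact localTypeISingularityExists_of_slabProfile hsw' hwg' hI' hsing'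

/-- **`_false_without_` the antecedent's singularity, in the (L)-world**: if no suitable weak
solution has a local Type I singular point, the weakened crux is false — whereas the crux itself is
then true (`symmetricScarExists_of_not_localTypeISingularityExists`).  So the singularity hypothesis
of the antecedent is load-bearing: it is what makes the crux a SELECTION statement rather than a
construction. [cite: AlbrittonBarker2019, Thm 1.1] -/
theorem symmetricScarExists_false_without_singularAntecedent (hno : ¬ LocalTypeISingularityExists) :
    ¬ SymmetricScarExistsWithoutSingularAntecedent := fun h =>
  hno (localTypeISingularityExists_of_withoutSingularAntecedent h)

/-- Under `¬ LocalTypeISingularityExists` the crux and its weakening have OPPOSITE truth values.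
[cite: AlbrittonBarker2019, Thm 1.1] -/
theorem crux_and_not_weakened_of_not_localTypeISingularityExists (hno : ¬ LocalTypeISingularityExists) :
    SymmetricScarExists ∧ ¬ SymmetricScarExistsWithoutSingularAntecedent :=
  ⟨symmetricScarExists_of_not_localTypeISingularityExists hno,
    symmetricScarExists_false_without_singularAntecedent hno⟩

end LoadBearing

end Summit.NavierStokesRegularity.NavierStokesRegularity.Theorems.SymmetricScarExists.Negative
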